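import Literature.IUT.HodgeArakelov.LabelClassesOfCuspsLevelTieGenuine
import Literature.IUT.HodgeArakelov.LabelledDecompositionNonVacuity
import HarnessLib

/-!
# [IUTchII] Def 2.3 (iii)–(v) at the GENUINE tower: ONE cuspidal datum carries BOTH levels — `Def23_structuresConj Dec C` HOLDS at
# `PlusMinusTower.ofCoverModel` (any injective profinite completion `ι`; `ofPiCHat` is the instance `ι = toPiCHat`) for a SINGLE datum `C`, with the
# natural level map `LabCusp^±(Π_v) → LabCusp^±(Π̂^±_v)` typed on it

S. Mochizuki, *Inter-universal Teichmüller theory II*, kurims manuscript (Dec. 2020), §2 Def 2.3 (ii) p. 68, (iii) p. 68, (v) p. 69 («one verifies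
immediately» that the label-class structures exist) [claim: Mochizuki2012, status: disputed] (IUTchII §2 Def 2.3 (v), kurims p.69) (D-0012 claim key;
record-only).  Inputs in print: [SemiAnbd] Thm 6.5 (ii)/(iii) pp. 71–72 [cite: MochizukiSemiAnbd2006, Thm 6.5(ii) p.71]; [AbsTopI] Lem 4.5 (vi) p. 55
[cite: MochizukiAbsTopI2012, Lemma 4.5 (vi) p.55]; [EtTh] Def 2.1 p. 36, Def 2.5 (i) p. 39 [cite: MochizukiEtTh2009, Def 2.5 (i) p.39].

abc-iut cell, seat abc-iut-w5-d132 (gen 7).  WHY: the data of record SPLIT the levels (level-`Π_v` datum p456452; profinite datum p432649 whose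
clause `hCu` is stated at EVERY level), so the single-datum predicate `Def23_structuresConj Dec C` (abc-iut-w5-d243, p436492) had its two conjuncts
inhabited on TWO data and, on ONE datum, only TOY inhabitants (`FlTorsorStructureConjWitnesses`); GAP-LEDGER G-w5d243-2 wants `imageV` typed on ONE
`C`.  PROOF-ONLY (no `def`, no instance, no new named fact):
§1 the hatted chain from the `Π̂^±_v`-LEVEL CLAUSE ALONE (generalises p448608 / p449023 / p450102): `isCuspidalInertia_pmHat_iff_of_hatClause`
 (homogeneity, transported from the p432649 datum through the shared clause), `conjStable_of_hatClause`, `card_labCuspPM_eq_l_of_hatClause` (mod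
 `h45vi`), `mem_pmHat_of_forall_conjClass_eq_of_hatClause` (mod `hR1c`), `nonempty_flTorsorStructureConj_of_hatClause` — at the PARAMETRIC tower;
§2 the `Π_v`-level chain from HOMOGENEITY ALONE: `card_labCuspPM_piV_eq_l_of_hom`, `nonempty_labCuspStructure_of_hom` (p456452's count);
§3 ONE DATUM: `piV_ne_pmHat`; `conj_smul_inf_piV_of_rmk231` (Rmk 2.3.1 ⇒ `(r Ĵ₀ r⁻¹) ∩ Π_v = r (Ĵ₀ ∩ Π_v) r⁻¹`);
 **`exists_singleDatum_def23_structuresConj_ofCoverModel`** — ONE `C` (intersection clause at `Π_v`, profinite clause elsewhere) with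
 `Def23_structuresConj Dec C` for EVERY `Dec` (Def 2.3 (iv) record free, w5-d219) AND the natural level map `f : LabCuspPM C W.piV W.piPM →
 LabCuspPM C W.pmHat W.pmHat` (p489713 shape) existing, BIJECTIVE, and tying a level structure to a successor structure (`L.toFl = F.chart ∘ f`).
 Binders = those of p456452 / p449023 / p450102 ({F-1658 `h65`/`h65ii`, F-1674 `h65iii`, F-0207-at-the-instance `h45vi`, (R1c) `hR1c`, `op`, «unique
 cusp», `hZ`, `hN`}) + the first claim of Rmk 2.3.1 for the tempered cusp family (`hR231`, abc-iut-L6-t19's theorem at the agreement datum).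
HONEST LABEL: theorems about the kernel's genuine tower over abc-iut-L2's [EtTh] interface data; the single datum carries the profinite clause pro
forma at the levels the typed predicate does not read (`Π^±_v`, `Π̂_v`, …); nothing of the series is asserted; no side taken on [IUTchIII] Cor 3.12;
typed ≠ proved; witnessed ≠ endorsed; nothing here asserts abc proved or refuted.
-/

noncomputable section

namespace Literature.IUT.HodgeArakelov

open Literature.AnabelianGeometry Literature.AnabelianGeometry.EtaleTheta Literature.AnabelianGeometry.SemiGraphs
open scoped Pointwise

namespace PlusMinusTower

variable {p : ℕ} [Fact p.Prime] {M : MuTwoSetting p} (e : M.CLevelData)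
  {E : M.toThetaSetting.EtaleThetaData} {l : ℕ} (C : E.DoubleUnderline l) {N : ℕ+}
  (μ : M.toThetaSetting.CyclotomeMod l N) (hC : M.toThetaSetting.Compat) (hS : M.toThetaSetting.Sec2Hyps)
  (hl : l.Prime) (hp2 : p ≠ 2) (hpl : p ≠ l) (hζ : ∃ ζ : M.toThetaSetting.K, IsPrimitiveRoot ζ (4 * l))
  {η : (C.thetaEnvData μ hC hS).PiYdd → MuN p N} (hη : η ∈ (C.thetaEnvData μ hC hS).thetaCocycles)
  {Q : Type} [Group Q] [TopologicalSpace Q] [IsTopologicalGroup Q]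
  (ι : M.GtpC →ₜ* Q) (hι : IsProfiniteCompletion ι) (hinj : Function.Injective ι)
  (Φ : Q →* GQp p) (hΦ : ∀ g : M.GtpC, Φ (ι g) = e.augC g) (hΦK : Φ.range = M.GK)
  (hZ : Thm16Sub.KerToZIsCompactlyGenerated M.toThetaSetting) (hN : (C.Huu.subgroupOf (M.GtpXu l)).Normal)
  {P : TopGroup.{0}} (T : TemperedCoverings (BadPlaceSetting.ofUnderline C μ hC hS hl hp2 hpl hζ hη) P) {x₀ : M.Pt}

/-! ## 1. The hatted chain from the `Π̂^±_v`-level clause alone -/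

section HatClause

variable (Cm : CuspidalInertiaData (ofCoverModel e C μ hC hS hl hp2 hpl hζ hη ι hι hinj Φ hΦ hΦK hZ hN T))
  (hHat : ∀ J : Subgroup (ofCoverModel e C μ hC hS hl hp2 hpl hζ hη ι hι hinj Φ hΦ hΦK hZ hN T).Corhat,
    Cm.IsCuspidalInertia (ofCoverModel e C μ hC hS hl hp2 hpl hζ hη ι hι hinj Φ hΦ hΦK hZ hN T).pmHat J ↔
      J ≤ (ofCoverModel e C μ hC hS hl hp2 hpl hζ hη ι hι hinj Φ hΦ hΦK hZ hN T).pmHat ∧ ∃ i : {x : M.Pt // M.IsCusp x} × M.GtpC,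
        ∃ γ ∈ (ofCoverModel e C μ hC hS hl hp2 hpl hζ hη ι hι hinj Φ hΦ hΦK hZ hN T).pmHat,
          J = MulAut.conj γ •
            ((((MulAut.conj i.2 • (M.toTemperedCurve.inertia i.1.1).map M.inclX) ⊓ (M.GtpXu l).map M.inclX).map
              ι.toMonoidHom : Subgroup (ofCoverModel e C μ hC hS hl hp2 hpl hζ hη ι hι hinj Φ hΦ hΦK hZ hN T).Corhat)).topologicalClosure)

include hHat in
/-- **HOMOGENEITY from the `Π̂^±_v`-clause alone**: the cusps of `Π̂^±_v` are the `Π̂^cor_v`-conjugates of `Ĵ₀ = ι(inclX I_{x₀})` (transported from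
p448608 for the p432649-type datum, which shares the clause). ([IUTchII] Def 2.3 (ii), Rmk 2.3.1, kurims pp.68–69) [claim: Mochizuki2012, status: disputed] -/
theorem isCuspidalInertia_pmHat_iff_of_hatClause (op : M.toThetaSetting.OncePuncturedData) (hx₀ : M.IsCusp x₀)
    (huniq : ∀ x' : M.Pt, M.IsCusp x' → x' = x₀)
    (J : Subgroup (ofCoverModel e C μ hC hS hl hp2 hpl hζ hη ι hι hinj Φ hΦ hΦK hZ hN T).Corhat) :
    Cm.IsCuspidalInertia (ofCoverModel e C μ hC hS hl hp2 hpl hζ hη ι hι hinj Φ hΦ hΦK hZ hN T).pmHat J ↔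
      ∃ q : (ofCoverModel e C μ hC hS hl hp2 hpl hζ hη ι hι hinj Φ hΦ hΦK hZ hN T).Corhat,
        J = MulAut.conj q • (((M.toTemperedCurve.inertia x₀).map M.inclX).map ι.toMonoidHom :
          Subgroup (ofCoverModel e C μ hC hS hl hp2 hpl hζ hη ι hι hinj Φ hΦ hΦK hZ hN T).Corhat) := by
  obtain ⟨CuHat, hCu, -⟩ := exists_cuspidalInertiaDataHat_ofCoverModel e C μ hC hS hl hp2 hpl hζ hη ι hι hinj Φ hΦ hΦK hZ hN T
  exact (hHat J).trans ((hCu _ J).symm.trans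
    (isCuspidalInertia_pmHat_iff e C μ hC hS hl hp2 hpl hζ hη ι hι hinj Φ hΦ hΦK hZ hN T op hx₀ huniq CuHat hCu J))

include hHat in
/-- **Law (a)** (`ConjStable`) from the `Π̂^±_v`-clause alone. ([IUTchII] Rmk 2.3.1, kurims p.69) [claim: Mochizuki2012, status: disputed] -/
theorem conjStable_of_hatClause (op : M.toThetaSetting.OncePuncturedData) (hx₀ : M.IsCusp x₀)
    (huniq : ∀ x' : M.Pt, M.IsCusp x' → x' = x₀) : Cm.ConjStable := by
  rw [CuspidalInertiaData.conjStable_iff_smul]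
  intro g I hI
  rw [isCuspidalInertia_pmHat_iff_of_hatClause e C μ hC hS hl hp2 hpl hζ hη ι hι hinj Φ hΦ hΦK hZ hN T Cm hHat op hx₀ huniq] at hI ⊢
  obtain ⟨q, rfl⟩ := hI
  exact ⟨g * q, by rw [map_mul, mul_smul]⟩

include hHat in
/-- **`|LabCusp^±(Π̂^±_v)| = l`** from the `Π̂^±_v`-clause alone (p447018's group theory, p448608's inputs; mod `h45vi`, F-1674, `op`, «unique cusp»). ([IUTchII] Def 2.3 (iii)/(v), kurims pp.68–69) [claim: Mochizuki2012, status: disputed] -/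
theorem card_labCuspPM_eq_l_of_hatClause (op : M.toThetaSetting.OncePuncturedData) (hx₀ : M.IsCusp x₀)
    (huniq : ∀ x' : M.Pt, M.IsCusp x' → x' = x₀) (h65iii : M.toTemperedCurve.IsoPreservesCuspidalDecomp M.toTemperedCurve)
    (h45vi : Subgroup.normalizer ((((M.toTemperedCurve.inertia x₀).map M.inclX).map ι.toMonoidHom : Subgroup Q) : Set Q) ⊓
        (M.inclX.range.map ι.toMonoidHom).topologicalClosure ≤ ((M.decomp x₀).map M.inclX).map ι.toMonoidHom) :
    Nat.card (LabCuspPM Cm (ofCoverModel e C μ hC hS hl hp2 hpl hζ hη ι hι hinj Φ hΦ hΦK hZ hN T).pmHat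
      (ofCoverModel e C μ hC hS hl hp2 hpl hζ hη ι hι hinj Φ hΦ hΦK hZ hN T).pmHat) =
        (BadPlaceSetting.ofUnderline C μ hC hS hl hp2 hpl hζ hη).l := by
  let ιW : M.GtpC →* (ofCoverModel e C μ hC hS hl hp2 hpl hζ hη ι hι hinj Φ hΦ hΦK hZ hN T).Corhat := ι.toMonoidHom
  obtain ⟨g, hgX, hgD⟩ := exists_ι_not_mem_closure_conj_map_decomp e ι hι hx₀ huniq h65iii
  refine card_labCuspPM_eq_l_of_inputs (C := Cm)
    (J₀ := ((M.toTemperedCurve.inertia x₀).map M.inclX).map ιW)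
    (Xh := (M.inclX.range.map ιW).topologicalClosure) (D := ((M.decomp x₀).map M.inclX).map ιW) (q₁ := ιW g)
    (map_inertia_le_pmHat e C μ hC hS hl hp2 hpl hζ hη ι hι hinj Φ hΦ hΦK hZ hN T op hx₀)
    (isCuspidalInertia_pmHat_iff_of_hatClause e C μ hC hS hl hp2 hpl hζ hη ι hι hinj Φ hΦ hΦK hZ hN T Cm hHat op hx₀ huniq)
    (index_closure_range_inclX ι hι) ?_ ?_ (map_decomp_le_normalizer_map_inertia ι) h45vi
    (fun q hq => conj_smul_map_inertia_of_decomp e ι Φ hΦ q hq) hgX hgD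
    (ofCoverModel_indices e C μ hC hS hl hp2 hpl hζ hη ι hι hinj Φ hΦ hΦK hZ hN T).1
  · change ((((M.GtpXu l).map M.inclX).map ι.toMonoidHom).topologicalClosure : Subgroup Q) ≤
      (M.inclX.range.map ι.toMonoidHom).topologicalClosure
    exact Subgroup.topologicalClosure_mono (Subgroup.map_mono (Subgroup.map_le_range _ _))
  · change (((M.decomp x₀).map M.inclX).map ι.toMonoidHom : Subgroup Q) ≤
      (((M.GtpXu l).map M.inclX).map ι.toMonoidHom).topologicalClosure
    exact (Subgroup.map_mono (Subgroup.map_mono (decomp_le_GtpXu op hx₀))).trans (Subgroup.le_topologicalClosure _)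

include hHat in
/-- **Faithfulness** from the `Π̂^±_v`-clause alone: an element fixing every `±`-label class of `Π̂^±_v` lies in `Π̂^±_v` (p449861 + p450102's inputs; mod `h45vi`, `hR1c`). ([IUTchII] Def 2.3 (v), kurims p.69) [claim: Mochizuki2012, status: disputed] -/
theorem mem_pmHat_of_forall_conjClass_eq_of_hatClause (op : M.toThetaSetting.OncePuncturedData) (hx₀ : M.IsCusp x₀)
    (huniq : ∀ x' : M.Pt, M.IsCusp x' → x' = x₀) (h65iii : M.toTemperedCurve.IsoPreservesCuspidalDecomp M.toTemperedCurve)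
    (h45vi : Subgroup.normalizer ((((M.toTemperedCurve.inertia x₀).map M.inclX).map ι.toMonoidHom : Subgroup Q) : Set Q) ⊓
        (M.inclX.range.map ι.toMonoidHom).topologicalClosure ≤ ((M.decomp x₀).map M.inclX).map ι.toMonoidHom)
    (hR1c : ∀ w : M.PiTemp, M.toZ (e.conjX M.epsPM w) = (M.toZ w)⁻¹)
    (g : (ofCoverModel e C μ hC hS hl hp2 hpl hζ hη ι hι hinj Φ hΦ hΦK hZ hN T).Corhat)
    (hg : ∀ t, (conjStable_of_hatClause e C μ hC hS hl hp2 hpl hζ hη ι hι hinj Φ hΦ hΦK hZ hN T Cm hHat op hx₀ huniq).conjClass g t = t) :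
    g ∈ (ofCoverModel e C μ hC hS hl hp2 hpl hζ hη ι hι hinj Φ hΦ hΦK hZ hN T).pmHat := by
  let ιW : M.GtpC →* (ofCoverModel e C μ hC hS hl hp2 hpl hζ hη ι hι hinj Φ hΦ hΦK hZ hN T).Corhat := ι.toMonoidHom
  obtain ⟨g₀, hgX, hgD⟩ := exists_ι_not_mem_closure_conj_map_decomp e ι hι hx₀ huniq h65iii
  have hg₀ : g₀ ∉ M.inclX.range := fun h => hgX ((mem_closure_range_inclX_iff ι hι g₀).mpr h)
  obtain ⟨z₀, hz₀⟩ := M.toZ_surjective (Multiplicative.ofAdd (1 : ℤ))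
  have hcomm : (ιW g₀)⁻¹ * (ιW (M.inclX z₀))⁻¹ * ιW g₀ * ιW (M.inclX z₀) ∉
      (ofCoverModel e C μ hC hS hl hp2 hpl hζ hη ι hι hinj Φ hΦ hΦK hZ hN T).pmHat := by
    rw [← map_inv, ← map_inv, ← map_mul, ← map_mul, ← map_mul]
    exact ι_comm_not_mem_closure e hl ι hι (BadPlaceSetting.ofUnderline C μ hC hS hl hp2 hpl hζ hη).l_odd hR1c hg₀ hz₀
  refine mem_pmHat_of_forall_conjClass_eq (C := Cm)
    (J₀ := ((M.toTemperedCurve.inertia x₀).map M.inclX).map ιW)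
    (Xh := (M.inclX.range.map ιW).topologicalClosure) (D := ((M.decomp x₀).map M.inclX).map ιW) (q₁ := ιW g₀)
    (map_inertia_le_pmHat e C μ hC hS hl hp2 hpl hζ hη ι hι hinj Φ hΦ hΦK hZ hN T op hx₀)
    (isCuspidalInertia_pmHat_iff_of_hatClause e C μ hC hS hl hp2 hpl hζ hη ι hι hinj Φ hΦ hΦK hZ hN T Cm hHat op hx₀ huniq)
    _ (index_closure_range_inclX ι hι) ?_ ?_ (map_decomp_le_normalizer_map_inertia ι) h45vi
    (fun q hq => conj_smul_map_inertia_of_decomp e ι Φ hΦ q hq) hgX hgD hcomm hg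
  · change ((((M.GtpXu l).map M.inclX).map ι.toMonoidHom).topologicalClosure : Subgroup Q) ≤
      (M.inclX.range.map ι.toMonoidHom).topologicalClosure
    exact Subgroup.topologicalClosure_mono (Subgroup.map_mono (Subgroup.map_le_range _ _))
  · change (((M.decomp x₀).map M.inclX).map ι.toMonoidHom : Subgroup Q) ≤
      (((M.GtpXu l).map M.inclX).map ι.toMonoidHom).topologicalClosure
    exact (Subgroup.map_mono (Subgroup.map_mono (decomp_le_GtpXu op hx₀))).trans (Subgroup.le_topologicalClosure _)

include hHat in
/-- **THE Def 2.3 (v) SUCCESSOR STRUCTURE EXISTS from the `Π̂^±_v`-clause alone, at the PARAMETRIC tower** (criterion p440082 with (i), (ii), (iv) above). ([IUTchII] Def 2.3 (v), kurims p.69) [claim: Mochizuki2012, status: disputed] -/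
theorem nonempty_flTorsorStructureConj_of_hatClause (op : M.toThetaSetting.OncePuncturedData) (hx₀ : M.IsCusp x₀)
    (huniq : ∀ x' : M.Pt, M.IsCusp x' → x' = x₀) (h65iii : M.toTemperedCurve.IsoPreservesCuspidalDecomp M.toTemperedCurve)
    (h45vi : Subgroup.normalizer ((((M.toTemperedCurve.inertia x₀).map M.inclX).map ι.toMonoidHom : Subgroup Q) : Set Q) ⊓
        (M.inclX.range.map ι.toMonoidHom).topologicalClosure ≤ ((M.decomp x₀).map M.inclX).map ι.toMonoidHom)
    (hR1c : ∀ w : M.PiTemp, M.toZ (e.conjX M.epsPM w) = (M.toZ w)⁻¹) : Nonempty (FlTorsorStructureConj Cm) :=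
  FlTorsorStructureConj.nonempty_iff_conjStable_card_ker.mpr
    ⟨conjStable_of_hatClause e C μ hC hS hl hp2 hpl hζ hη ι hι hinj Φ hΦ hΦK hZ hN T Cm hHat op hx₀ huniq,
      card_labCuspPM_eq_l_of_hatClause e C μ hC hS hl hp2 hpl hζ hη ι hι hinj Φ hΦ hΦK hZ hN T Cm hHat op hx₀ huniq h65iii h45vi,
      fun g hg => mem_pmHat_of_forall_conjClass_eq_of_hatClause e C μ hC hS hl hp2 hpl hζ hη ι hι hinj Φ hΦ hΦK hZ hN T Cm hHat op hx₀
        huniq h65iii h45vi hR1c g hg⟩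

end HatClause

/-! ## 2. The `Π_v`-level chain from homogeneity alone -/

section Hom

variable (Cm : CuspidalInertiaData (ofCoverModel e C μ hC hS hl hp2 hpl hζ hη ι hι hinj Φ hΦ hΦK hZ hN T))
  (hV : ∀ J : Subgroup (ofCoverModel e C μ hC hS hl hp2 hpl hζ hη ι hι hinj Φ hΦ hΦK hZ hN T).Corhat,
    Cm.IsCuspidalInertia (ofCoverModel e C μ hC hS hl hp2 hpl hζ hη ι hι hinj Φ hΦ hΦK hZ hN T).piV J ↔
      ∃ r ∈ (M.inclX.range.map ι.toMonoidHom : Subgroup (ofCoverModel e C μ hC hS hl hp2 hpl hζ hη ι hι hinj Φ hΦ hΦK hZ hN T).Corhat),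
        J = MulAut.conj r • ((((M.toTemperedCurve.inertia x₀).map M.inclX).map ι.toMonoidHom :
            Subgroup (ofCoverModel e C μ hC hS hl hp2 hpl hζ hη ι hι hinj Φ hΦ hΦK hZ hN T).Corhat) ⊓
          (ofCoverModel e C μ hC hS hl hp2 hpl hζ hη ι hι hinj Φ hΦ hΦK hZ hN T).piV))

include hV in
/-- **`|LabCusp^±(Π_v)| = l` from `Π_v`-homogeneity alone** (p455509 inside `R = ι(inclX Π^tp_X)`; stabiliser `= Π^±_v` by [SemiAnbd] Thm 6.5 (ii), F-1658 BY NAME). ([IUTchII] Def 2.3 (iii), kurims p.68) [claim: Mochizuki2012, status: disputed] -/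
theorem card_labCuspPM_piV_eq_l_of_hom (op : M.toThetaSetting.OncePuncturedData) (hx₀ : M.IsCusp x₀)
    (h65 : M.toTemperedCurve.DecompCommensurablyTerminal) (h65ii : M.toTemperedCurve.DecompEqCommensuratorOfOpenInertia) :
    Nat.card (LabCuspPM Cm (ofCoverModel e C μ hC hS hl hp2 hpl hζ hη ι hι hinj Φ hΦ hΦK hZ hN T).piV
      (ofCoverModel e C μ hC hS hl hp2 hpl hζ hη ι hι hinj Φ hΦ hΦK hZ hN T).piPM) = l := by
  have hPM : (ofCoverModel e C μ hC hS hl hp2 hpl hζ hη ι hι hinj Φ hΦ hΦK hZ hN T).piPM =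
      (((M.GtpXu l).map M.inclX).map ι.toMonoidHom : Subgroup (ofCoverModel e C μ hC hS hl hp2 hpl hζ hη ι hι hinj Φ hΦ hΦK hZ hN T).Corhat) :=
    piPM_ofCoverModel e C μ hC hS hl hp2 hpl hζ hη ι hι hinj Φ hΦ hΦK hZ hN T
  rw [card_labCuspPM_level_eq_index
    (Qsub := (ofCoverModel e C μ hC hS hl hp2 hpl hζ hη ι hι hinj Φ hΦ hΦK hZ hN T).piV)
    (Qsup := (ofCoverModel e C μ hC hS hl hp2 hpl hζ hη ι hι hinj Φ hΦ hΦK hZ hN T).piPM)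
    (R := (M.inclX.range.map ι.toMonoidHom : Subgroup (ofCoverModel e C μ hC hS hl hp2 hpl hζ hη ι hι hinj Φ hΦ hΦK hZ hN T).Corhat))
    (inf_le_right.trans (ofCoverModel e C μ hC hS hl hp2 hpl hζ hη ι hι hinj Φ hΦ hΦK hZ hN T).piV_le_piPM)
    (piPM_le_rangeX e C μ hC hS hl hp2 hpl hζ hη ι hι hinj Φ hΦ hΦK hZ hN T)
    (fun _ hr => conj_smul_piPM_of_mem_rangeX e C μ hC hS hl hp2 hpl hζ hη ι hι hinj Φ hΦ hΦK hZ hN T hr) hV]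
  have hsup : (Subgroup.normalizer ((Subgroup.normalizer
        (((((M.toTemperedCurve.inertia x₀).map M.inclX).map ι.toMonoidHom :
            Subgroup (ofCoverModel e C μ hC hS hl hp2 hpl hζ hη ι hι hinj Φ hΦ hΦK hZ hN T).Corhat) ⊓
          (ofCoverModel e C μ hC hS hl hp2 hpl hζ hη ι hι hinj Φ hΦ hΦK hZ hN T).piV : Subgroup _) : Set _) ⊓
        (ofCoverModel e C μ hC hS hl hp2 hpl hζ hη ι hι hinj Φ hΦ hΦK hZ hN T).piPM : Subgroup _) : Set _)).subgroupOf
        (M.inclX.range.map ι.toMonoidHom : Subgroup (ofCoverModel e C μ hC hS hl hp2 hpl hζ hη ι hι hinj Φ hΦ hΦK hZ hN T).Corhat) ≤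
      (ofCoverModel e C μ hC hS hl hp2 hpl hζ hη ι hι hinj Φ hΦ hΦK hZ hN T).piPM.subgroupOf (M.inclX.range.map ι.toMonoidHom) := by
    intro r hr
    rw [Subgroup.mem_subgroupOf] at hr ⊢
    exact normalizer_normalizer_inf_rangeX_le_piPM e C μ hC hS hl hp2 hpl hζ hη ι hι hinj Φ hΦ hΦK hZ hN T op hx₀ h65 h65ii ⟨hr, r.2⟩
  rw [sup_eq_right.mpr hsup, hPM]
  exact index_map_GtpXu_subgroupOf_rangeX ι hinj

include hV in
/-- **`LabCuspStructure` EXISTS from `Π_v`-homogeneity alone** (w5-d028's `nonempty_iff_nonempty_equiv` + the count). ([IUTchII] Def 2.3 (iii), kurims p.68) [claim: Mochizuki2012, status: disputed] -/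
theorem nonempty_labCuspStructure_of_hom (op : M.toThetaSetting.OncePuncturedData) (hx₀ : M.IsCusp x₀)
    (h65 : M.toTemperedCurve.DecompCommensurablyTerminal) (h65ii : M.toTemperedCurve.DecompEqCommensuratorOfOpenInertia) :
    Nonempty (LabCuspStructure Cm) := by
  rw [LabCuspStructure.nonempty_iff_nonempty_equiv]
  have hcard := card_labCuspPM_piV_eq_l_of_hom e C μ hC hS hl hp2 hpl hζ hη ι hι hinj Φ hΦ hΦK hZ hN T Cm hV op hx₀ h65 h65ii
  haveI : Finite (LabCuspPM Cm (ofCoverModel e C μ hC hS hl hp2 hpl hζ hη ι hι hinj Φ hΦ hΦK hZ hN T).piV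
      (ofCoverModel e C μ hC hS hl hp2 hpl hζ hη ι hι hinj Φ hΦ hΦK hZ hN T).piPM) :=
    Nat.finite_of_card_ne_zero (by rw [hcard]; exact hl.ne_zero)
  haveI : NeZero (BadPlaceSetting.ofUnderline C μ hC hS hl hp2 hpl hζ hη).l := ⟨hl.ne_zero⟩
  exact Finite.card_eq.mp (by rw [hcard, Nat.card_zmod]; rfl)

end Hom

/-! ## 3. One datum carrying both levels -/
section SingleDatum

/-- `Π_v ≠ Π̂^±_v` at the genuine tower (`Π_v ≤ Π̂_v` and `[Π̂^±_v : Π̂_v] = l ≠ 1`). ([IUTchII] Def 2.3 (i), kurims p.67) [claim: Mochizuki2012, status: disputed] -/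
theorem piV_ne_pmHat :
    (ofCoverModel e C μ hC hS hl hp2 hpl hζ hη ι hι hinj Φ hΦ hΦK hZ hN T).piV ≠
      (ofCoverModel e C μ hC hS hl hp2 hpl hζ hη ι hι hinj Φ hΦ hΦK hZ hN T).pmHat := by
  intro h
  have hle : (ofCoverModel e C μ hC hS hl hp2 hpl hζ hη ι hι hinj Φ hΦ hΦK hZ hN T).pmHat ≤
      (ofCoverModel e C μ hC hS hl hp2 hpl hζ hη ι hι hinj Φ hΦ hΦK hZ hN T).hat :=
    h.symm.le.trans (ofCoverModel e C μ hC hS hl hp2 hpl hζ hη ι hι hinj Φ hΦ hΦK hZ hN T).embP_le_hat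
  have hidx := (ofCoverModel_indices e C μ hC hS hl hp2 hpl hζ hη ι hι hinj Φ hΦ hΦK hZ hN T).2
  rw [Subgroup.relIndex_eq_one.mpr hle] at hidx
  exact hl.one_lt.ne hidx

/-- Conjugation commutes with «closure of the `n`-th powers»: `a · ⟨K^n⟩ · a⁻¹ = ⟨(a K a⁻¹)^n⟩`. [folklore] -/
private theorem conj_smul_closure_pow' {A : Type*} [Group A] (a : A) (K : Subgroup A) (n : ℕ) :
    MulAut.conj a • Subgroup.closure ((fun x : A => x ^ n) '' (K : Set A)) =
      Subgroup.closure ((fun x : A => x ^ n) '' ((MulAut.conj a • K : Subgroup A) : Set A)) := by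
  rw [conj_smul_eq_map_conj, MonoidHom.map_closure, Subgroup.coe_pointwise_smul, ← Set.image_smul, Set.image_image,
    Set.image_image]
  congr 1
  ext x
  simp [MulAut.conj_apply, conj_pow]

/-- **Rmk 2.3.1 ⇒ the intersections are conjugates**: if `(r Ĵ₀ r⁻¹) ∩ Π_v = (r Ĵ₀ r⁻¹)^l` for every `r ∈ ι(inclX Π^tp_X)` ([IUTchII] Rmk 2.3.1 for
the tempered cusp family; abc-iut-L6-t19 at the agreement datum), then `(r Ĵ₀ r⁻¹) ∩ Π_v = r (Ĵ₀ ∩ Π_v) r⁻¹`. ([IUTchII] Rmk 2.3.1, kurims p.69) [claim: Mochizuki2012, status: disputed] -/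
theorem conj_smul_inf_piV_of_rmk231
    (hR231 : ∀ r ∈ (M.inclX.range.map ι.toMonoidHom : Subgroup (ofCoverModel e C μ hC hS hl hp2 hpl hζ hη ι hι hinj Φ hΦ hΦK hZ hN T).Corhat),
      (MulAut.conj r • (((M.toTemperedCurve.inertia x₀).map M.inclX).map ι.toMonoidHom :
                Subgroup (ofCoverModel e C μ hC hS hl hp2 hpl hζ hη ι hι hinj Φ hΦ hΦK hZ hN T).Corhat)) ⊓
          (ofCoverModel e C μ hC hS hl hp2 hpl hζ hη ι hι hinj Φ hΦ hΦK hZ hN T).piV =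
        Subgroup.closure ((fun x => x ^ l) '' ((MulAut.conj r • (((M.toTemperedCurve.inertia x₀).map M.inclX).map ι.toMonoidHom :
                Subgroup (ofCoverModel e C μ hC hS hl hp2 hpl hζ hη ι hι hinj Φ hΦ hΦK hZ hN T).Corhat) : Subgroup _) : Set _)))
    {r : (ofCoverModel e C μ hC hS hl hp2 hpl hζ hη ι hι hinj Φ hΦ hΦK hZ hN T).Corhat} (hr : r ∈ (M.inclX.range.map ι.toMonoidHom : Subgroup (ofCoverModel e C μ hC hS hl hp2 hpl hζ hη ι hι hinj Φ hΦ hΦK hZ hN T).Corhat)) :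
    (MulAut.conj r • (((M.toTemperedCurve.inertia x₀).map M.inclX).map ι.toMonoidHom :
                Subgroup (ofCoverModel e C μ hC hS hl hp2 hpl hζ hη ι hι hinj Φ hΦ hΦK hZ hN T).Corhat)) ⊓
        (ofCoverModel e C μ hC hS hl hp2 hpl hζ hη ι hι hinj Φ hΦ hΦK hZ hN T).piV =
      MulAut.conj r • ((((M.toTemperedCurve.inertia x₀).map M.inclX).map ι.toMonoidHom :
                Subgroup (ofCoverModel e C μ hC hS hl hp2 hpl hζ hη ι hι hinj Φ hΦ hΦK hZ hN T).Corhat) ⊓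
        (ofCoverModel e C μ hC hS hl hp2 hpl hζ hη ι hι hinj Φ hΦ hΦK hZ hN T).piV) := by
  have h1 := hR231 1 (Subgroup.one_mem _)
  rw [map_one, one_smul] at h1
  rw [hR231 r hr, h1, conj_smul_closure_pow']

/-- **ONE DATUM FOR BOTH LEVELS — `Def23_structuresConj Dec C` AT THE GENUINE TOWER `ofCoverModel`, with the natural level map typed ON IT.**
There is a single `C : CuspidalInertiaData W` whose cusps of `Π_v` are the intersections `(r Ĵ₀ r⁻¹) ∩ Π_v`, `r ∈ ι(inclX Π^tp_X)` (Def 2.3 (ii):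
«the intersections with `Π_⊆` of those cuspidal inertia groups of `Π_⊇` …») and whose cusps of `Π̂^±_v` are the `Π̂^±_v`-conjugates of the closures
of the cusp family (p432649 clause), such that: for EVERY Prop 2.2 decomposition datum `Dec`, `Def23_structuresConj Dec C` (Def 2.3 (iii) structure +
(iv) record + (v) successor structure with conjugation action and `Π̂^cor_v/Π̂^±_v ≃* 𝔽_l^{⋊±}`) HOLDS; and the natural map
`f : LabCuspPM C W.piV W.piPM → LabCuspPM C W.pmHat W.pmHat`, `⟦r (Ĵ₀ ∩ Π_v) r⁻¹⟧ ↦ ⟦r Ĵ₀ r⁻¹⟧`, EXISTS, is BIJECTIVE, and ties SOME level structure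
to SOME successor structure: `L.toFl = F.chart ∘ f` (G-w5d243-2 shape, ONE datum).  Modulo the binders of p456452 / p449023 / p450102 and the
first claim of Rmk 2.3.1 for the tempered cusp family (`hR231`, abc-iut-L6-t19's theorem at the agreement datum) — nothing new.
([IUTchII] Def 2.3 (iii)–(v), kurims pp.68–69) [claim: Mochizuki2012, status: disputed] -/
theorem exists_singleDatum_def23_structuresConj_ofCoverModel (op : M.toThetaSetting.OncePuncturedData) (hx₀ : M.IsCusp x₀)
    (huniq : ∀ x' : M.Pt, M.IsCusp x' → x' = x₀) (h65 : M.toTemperedCurve.DecompCommensurablyTerminal)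
    (h65ii : M.toTemperedCurve.DecompEqCommensuratorOfOpenInertia) (h65iii : M.toTemperedCurve.IsoPreservesCuspidalDecomp M.toTemperedCurve)
    (h45vi : Subgroup.normalizer ((((M.toTemperedCurve.inertia x₀).map M.inclX).map ι.toMonoidHom : Subgroup Q) : Set Q) ⊓
        (M.inclX.range.map ι.toMonoidHom).topologicalClosure ≤ ((M.decomp x₀).map M.inclX).map ι.toMonoidHom)
    (hR1c : ∀ w : M.PiTemp, M.toZ (e.conjX M.epsPM w) = (M.toZ w)⁻¹)
    (hR231 : ∀ r ∈ (M.inclX.range.map ι.toMonoidHom : Subgroup (ofCoverModel e C μ hC hS hl hp2 hpl hζ hη ι hι hinj Φ hΦ hΦK hZ hN T).Corhat),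
      (MulAut.conj r • (((M.toTemperedCurve.inertia x₀).map M.inclX).map ι.toMonoidHom :
                Subgroup (ofCoverModel e C μ hC hS hl hp2 hpl hζ hη ι hι hinj Φ hΦ hΦK hZ hN T).Corhat)) ⊓
          (ofCoverModel e C μ hC hS hl hp2 hpl hζ hη ι hι hinj Φ hΦ hΦK hZ hN T).piV =
        Subgroup.closure ((fun x => x ^ l) '' ((MulAut.conj r • (((M.toTemperedCurve.inertia x₀).map M.inclX).map ι.toMonoidHom :
                Subgroup (ofCoverModel e C μ hC hS hl hp2 hpl hζ hη ι hι hinj Φ hΦ hΦK hZ hN T).Corhat) : Subgroup _) : Set _))) :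
    ∃ Cm : CuspidalInertiaData (ofCoverModel e C μ hC hS hl hp2 hpl hζ hη ι hι hinj Φ hΦ hΦK hZ hN T),
      (∀ J, Cm.IsCuspidalInertia (ofCoverModel e C μ hC hS hl hp2 hpl hζ hη ι hι hinj Φ hΦ hΦK hZ hN T).piV J ↔
        ∃ r ∈ (M.inclX.range.map ι.toMonoidHom : Subgroup (ofCoverModel e C μ hC hS hl hp2 hpl hζ hη ι hι hinj Φ hΦ hΦK hZ hN T).Corhat),
          J = (MulAut.conj r • (((M.toTemperedCurve.inertia x₀).map M.inclX).map ι.toMonoidHom :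
                Subgroup (ofCoverModel e C μ hC hS hl hp2 hpl hζ hη ι hι hinj Φ hΦ hΦK hZ hN T).Corhat)) ⊓
            (ofCoverModel e C μ hC hS hl hp2 hpl hζ hη ι hι hinj Φ hΦ hΦK hZ hN T).piV) ∧
      (∀ Q', Q' ≠ (ofCoverModel e C μ hC hS hl hp2 hpl hζ hη ι hι hinj Φ hΦ hΦK hZ hN T).piV → ∀ J,
        Cm.IsCuspidalInertia Q' J ↔ J ≤ Q' ∧ ∃ i : {x : M.Pt // M.IsCusp x} × M.GtpC,
          ∃ γ ∈ (ofCoverModel e C μ hC hS hl hp2 hpl hζ hη ι hι hinj Φ hΦ hΦK hZ hN T).pmHat,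
            J = MulAut.conj γ •
              ((((MulAut.conj i.2 • (M.toTemperedCurve.inertia i.1.1).map M.inclX) ⊓ (M.GtpXu l).map M.inclX).map
                ι.toMonoidHom : Subgroup (ofCoverModel e C μ hC hS hl hp2 hpl hζ hη ι hι hinj Φ hΦ hΦK hZ hN T).Corhat)).topologicalClosure) ∧
      (∀ {D : EtaleThetaData (BadPlaceSetting.ofUnderline C μ hC hS hl hp2 hpl hζ hη).toThetaSetting P}
          (Dec : SubgraphDecomposition (BadPlaceSetting.ofUnderline C μ hC hS hl hp2 hpl hζ hη) T D), Def23_structuresConj Dec Cm) ∧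
      ∃ f : LabCuspPM Cm (ofCoverModel e C μ hC hS hl hp2 hpl hζ hη ι hι hinj Φ hΦ hΦK hZ hN T).piV
          (ofCoverModel e C μ hC hS hl hp2 hpl hζ hη ι hι hinj Φ hΦ hΦK hZ hN T).piPM →
        LabCuspPM Cm (ofCoverModel e C μ hC hS hl hp2 hpl hζ hη ι hι hinj Φ hΦ hΦK hZ hN T).pmHat
          (ofCoverModel e C μ hC hS hl hp2 hpl hζ hη ι hι hinj Φ hΦ hΦK hZ hN T).pmHat,
        Function.Bijective f ∧
        (∀ r ∈ (M.inclX.range.map ι.toMonoidHom : Subgroup (ofCoverModel e C μ hC hS hl hp2 hpl hζ hη ι hι hinj Φ hΦ hΦK hZ hN T).Corhat),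
          ∀ (I : {I // Cm.IsCuspidalInertia (ofCoverModel e C μ hC hS hl hp2 hpl hζ hη ι hι hinj Φ hΦ hΦK hZ hN T).piV I})
            (J : {I // Cm.IsCuspidalInertia (ofCoverModel e C μ hC hS hl hp2 hpl hζ hη ι hι hinj Φ hΦ hΦK hZ hN T).pmHat I}),
            I.1 = MulAut.conj r • ((((M.toTemperedCurve.inertia x₀).map M.inclX).map ι.toMonoidHom :
                Subgroup (ofCoverModel e C μ hC hS hl hp2 hpl hζ hη ι hι hinj Φ hΦ hΦK hZ hN T).Corhat) ⊓
              (ofCoverModel e C μ hC hS hl hp2 hpl hζ hη ι hι hinj Φ hΦ hΦK hZ hN T).piV) →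
            J.1 = MulAut.conj r • (((M.toTemperedCurve.inertia x₀).map M.inclX).map ι.toMonoidHom :
                Subgroup (ofCoverModel e C μ hC hS hl hp2 hpl hζ hη ι hι hinj Φ hΦ hΦK hZ hN T).Corhat) →
            f (Quot.mk _ I) = Quot.mk _ J) ∧
        ∃ (F : FlTorsorStructureConj Cm) (L : LabCuspStructure Cm), ∀ t, L.toFl t = F.chart (f t) := by
  -- the datum: tempered intersection clause at `Π_v`, profinite clause at every other level
  let Cm : CuspidalInertiaData (ofCoverModel e C μ hC hS hl hp2 hpl hζ hη ι hι hinj Φ hΦ hΦK hZ hN T) :=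
    { IsCuspidalInertia := fun Q' J =>
        (Q' = (ofCoverModel e C μ hC hS hl hp2 hpl hζ hη ι hι hinj Φ hΦ hΦK hZ hN T).piV ∧
          ∃ r ∈ (M.inclX.range.map ι.toMonoidHom : Subgroup (ofCoverModel e C μ hC hS hl hp2 hpl hζ hη ι hι hinj Φ hΦ hΦK hZ hN T).Corhat),
            J = (MulAut.conj r • (((M.toTemperedCurve.inertia x₀).map M.inclX).map ι.toMonoidHom :
                Subgroup (ofCoverModel e C μ hC hS hl hp2 hpl hζ hη ι hι hinj Φ hΦ hΦK hZ hN T).Corhat)) ⊓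
              (ofCoverModel e C μ hC hS hl hp2 hpl hζ hη ι hι hinj Φ hΦ hΦK hZ hN T).piV) ∨
        (Q' ≠ (ofCoverModel e C μ hC hS hl hp2 hpl hζ hη ι hι hinj Φ hΦ hΦK hZ hN T).piV ∧ J ≤ Q' ∧ ∃ i : {x : M.Pt // M.IsCusp x} × M.GtpC,
          ∃ γ ∈ (ofCoverModel e C μ hC hS hl hp2 hpl hζ hη ι hι hinj Φ hΦ hΦK hZ hN T).pmHat,
            J = MulAut.conj γ •
              ((((MulAut.conj i.2 • (M.toTemperedCurve.inertia i.1.1).map M.inclX) ⊓ (M.GtpXu l).map M.inclX).map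
                ι.toMonoidHom : Subgroup (ofCoverModel e C μ hC hS hl hp2 hpl hζ hη ι hι hinj Φ hΦ hΦK hZ hN T).Corhat)).topologicalClosure)
      le_of_isCuspidalInertia := by
        rintro Q' I (⟨rfl, r, -, rfl⟩ | ⟨-, hle, -⟩)
        · exact inf_le_right
        · exact hle }
  have hne := piV_ne_pmHat e C μ hC hS hl hp2 hpl hζ hη ι hι hinj Φ hΦ hΦK hZ hN T
  -- the two level clauses of `Cm`
  have hVint : ∀ J, Cm.IsCuspidalInertia (ofCoverModel e C μ hC hS hl hp2 hpl hζ hη ι hι hinj Φ hΦ hΦK hZ hN T).piV J ↔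
      ∃ r ∈ (M.inclX.range.map ι.toMonoidHom : Subgroup (ofCoverModel e C μ hC hS hl hp2 hpl hζ hη ι hι hinj Φ hΦ hΦK hZ hN T).Corhat),
        J = (MulAut.conj r • (((M.toTemperedCurve.inertia x₀).map M.inclX).map ι.toMonoidHom :
                Subgroup (ofCoverModel e C μ hC hS hl hp2 hpl hζ hη ι hι hinj Φ hΦ hΦK hZ hN T).Corhat)) ⊓
          (ofCoverModel e C μ hC hS hl hp2 hpl hζ hη ι hι hinj Φ hΦ hΦK hZ hN T).piV := by
    intro J
    change (_ ∨ _) ↔ _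
    exact ⟨fun h => h.elim (fun h => h.2) (fun h => absurd rfl h.1), fun h => Or.inl ⟨rfl, h⟩⟩
  have hOther : ∀ Q', Q' ≠ (ofCoverModel e C μ hC hS hl hp2 hpl hζ hη ι hι hinj Φ hΦ hΦK hZ hN T).piV → ∀ J,
      Cm.IsCuspidalInertia Q' J ↔ J ≤ Q' ∧ ∃ i : {x : M.Pt // M.IsCusp x} × M.GtpC,
          ∃ γ ∈ (ofCoverModel e C μ hC hS hl hp2 hpl hζ hη ι hι hinj Φ hΦ hΦK hZ hN T).pmHat,
            J = MulAut.conj γ •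
              ((((MulAut.conj i.2 • (M.toTemperedCurve.inertia i.1.1).map M.inclX) ⊓ (M.GtpXu l).map M.inclX).map
                ι.toMonoidHom : Subgroup (ofCoverModel e C μ hC hS hl hp2 hpl hζ hη ι hι hinj Φ hΦ hΦK hZ hN T).Corhat)).topologicalClosure := by
    intro Q' hQ' J
    change (_ ∨ _) ↔ _
    exact ⟨fun h => h.elim (fun h => absurd h.1 hQ') (fun h => h.2), fun h => Or.inr ⟨hQ', h⟩⟩
  have hHat := hOther _ hne.symm
  -- homogeneity at `Π_v` (Rmk 2.3.1)
  have hV : ∀ J, Cm.IsCuspidalInertia (ofCoverModel e C μ hC hS hl hp2 hpl hζ hη ι hι hinj Φ hΦ hΦK hZ hN T).piV J ↔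
      ∃ r ∈ (M.inclX.range.map ι.toMonoidHom : Subgroup (ofCoverModel e C μ hC hS hl hp2 hpl hζ hη ι hι hinj Φ hΦ hΦK hZ hN T).Corhat),
        J = MulAut.conj r • ((((M.toTemperedCurve.inertia x₀).map M.inclX).map ι.toMonoidHom :
                Subgroup (ofCoverModel e C μ hC hS hl hp2 hpl hζ hη ι hι hinj Φ hΦ hΦK hZ hN T).Corhat) ⊓
          (ofCoverModel e C μ hC hS hl hp2 hpl hζ hη ι hι hinj Φ hΦ hΦK hZ hN T).piV) := by
    intro J
    rw [hVint J]
    constructor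
    · rintro ⟨r, hr, rfl⟩
      exact ⟨r, hr, conj_smul_inf_piV_of_rmk231 e C μ hC hS hl hp2 hpl hζ hη ι hι hinj Φ hΦ hΦK hZ hN T hR231 hr⟩
    · rintro ⟨r, hr, rfl⟩
      exact ⟨r, hr, (conj_smul_inf_piV_of_rmk231 e C μ hC hS hl hp2 hpl hζ hη ι hι hinj Φ hΦ hΦK hZ hN T hR231 hr).symm⟩
  -- the two structures
  obtain ⟨L⟩ := nonempty_labCuspStructure_of_hom e C μ hC hS hl hp2 hpl hζ hη ι hι hinj Φ hΦ hΦK hZ hN T Cm hV op hx₀ h65 h65ii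
  have hF : Nonempty (FlTorsorStructureConj Cm) :=
    nonempty_flTorsorStructureConj_of_hatClause e C μ hC hS hl hp2 hpl hζ hη ι hι hinj Φ hΦ hΦK hZ hN T Cm hHat op hx₀ huniq h65iii h45vi hR1c
  -- the level map on the one datum
  have hC₂ := isCuspidalInertia_pmHat_iff_of_hatClause e C μ hC hS hl hp2 hpl hζ hη ι hι hinj Φ hΦ hΦK hZ hN T Cm hHat op hx₀ huniq
  obtain ⟨f, hf⟩ := exists_levelMap (C₁ := Cm) (C₂ := Cm)
    (R := (M.inclX.range.map ι.toMonoidHom : Subgroup (ofCoverModel e C μ hC hS hl hp2 hpl hζ hη ι hι hinj Φ hΦ hΦK hZ hN T).Corhat))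
    (inf_le_right.trans (ofCoverModel e C μ hC hS hl hp2 hpl hζ hη ι hι hinj Φ hΦ hΦK hZ hN T).piV_le_piPM)
    (piPM_le_rangeX e C μ hC hS hl hp2 hpl hζ hη ι hι hinj Φ hΦ hΦK hZ hN T)
    (fun _ hr => conj_smul_piPM_of_mem_rangeX e C μ hC hS hl hp2 hpl hζ hη ι hι hinj Φ hΦ hΦK hZ hN T hr) hV
    (normalizer_normalizer_inf_rangeX_le_piPM e C μ hC hS hl hp2 hpl hζ hη ι hι hinj Φ hΦ hΦK hZ hN T op hx₀ h65 h65ii)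
    (ofCoverModel e C μ hC hS hl hp2 hpl hζ hη ι hι hinj Φ hΦ hΦK hZ hN T).emb_le_pmHat
    (map_inertia_le_pmHat e C μ hC hS hl hp2 hpl hζ hη ι hι hinj Φ hΦ hΦK hZ hN T op hx₀) hC₂
  have hfinj : Function.Injective f :=
    levelMap_injective (C₁ := Cm) (C₂ := Cm)
      (inf_le_right.trans (ofCoverModel e C μ hC hS hl hp2 hpl hζ hη ι hι hinj Φ hΦ hΦK hZ hN T).piV_le_piPM)
      (fun _ hr => conj_smul_piPM_of_mem_rangeX e C μ hC hS hl hp2 hpl hζ hη ι hι hinj Φ hΦ hΦK hZ hN T hr) hV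
      (map_inertia_le_pmHat e C μ hC hS hl hp2 hpl hζ hη ι hι hinj Φ hΦ hΦK hZ hN T op hx₀) hC₂
      (stabHat_inf_rangeX_le_piPM e C μ hC hS hl hp2 hpl hζ hη ι hι hinj Φ hΦ hΦK hZ hN T op hx₀ h45vi) hf
  have hbij : Function.Bijective f :=
    levelMap_bijective_of_card_eq hfinj hl.ne_zero
      (card_labCuspPM_piV_eq_l_of_hom e C μ hC hS hl hp2 hpl hζ hη ι hι hinj Φ hΦ hΦK hZ hN T Cm hV op hx₀ h65 h65ii)
      (card_labCuspPM_eq_l_of_hatClause e C μ hC hS hl hp2 hpl hζ hη ι hι hinj Φ hΦ hΦK hZ hN T Cm hHat op hx₀ huniq h65iii h45vi)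
  obtain ⟨F⟩ := hF
  obtain ⟨L', hL', -, -⟩ := exists_labCuspStructure_toFl_eq_chart_comp hbij F.toFlTorsorStructure
  exact ⟨Cm, hVint, hOther, fun Dec => ⟨L, LabelledDecomposition.nonempty Dec L, ⟨F⟩⟩, f, hbij, hf, F, L', hL'⟩

end SingleDatum

end PlusMinusTower

end Literature.IUT.HodgeArakelov

end
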